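import Summits.CriticalPhenomena.PercolationContinuityZ3.Theorems.Transplant.PlanarSkeletonFrmQuasiDefs
import Summits.CriticalPhenomena.PercolationContinuityZ3.Theorems.Transplant.SkelFrmQuasiBChoiceRootClearR
import Summits.CriticalPhenomena.PercolationContinuityZ3.Theorems.Transplant.SkelFrmBChoiceRootClearR
import Summits.CriticalPhenomena.PercolationContinuityZ3.Theorems.Transplant.SkelFrmQuasi1ChoiceDefs
import Summits.CriticalPhenomena.PercolationContinuityZ3.Theorems.Transplant.SkelFrmQuasi1ParamsLBL
import Summits.CriticalPhenomena.PercolationContinuityZ3.Theorems.Transplant.SkelFrmQuasi1ParamsPO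
import Summits.CriticalPhenomena.PercolationContinuityZ3.Theorems.Transplant.SkelFrmQuasiBChoiceNums
import Summits.CriticalPhenomena.PercolationContinuityZ3.Theorems.Transplant.SkelFrmQuasiBChoiceReadNums
import Summits.CriticalPhenomena.PercolationContinuityZ3.Theorems.Transplant.SkelFrmQuasiBChoiceRootRunY
import Summits.CriticalPhenomena.PercolationContinuityZ3.Theorems.Transplant.SkelFrmQuasiBParamsCorrKG
import Summits.CriticalPhenomena.PercolationContinuityZ3.Theorems.Transplant.SkelFrmQuasiBParamsCorrKG0
import Summits.CriticalPhenomena.PercolationContinuityZ3.Theorems.Transplant.SkelFrmQuasiBParamsCorrKGLen3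
import Summits.CriticalPhenomena.PercolationContinuityZ3.Theorems.Transplant.SkelFrmQuasiBParamsCorrKGY
import Summits.CriticalPhenomena.PercolationContinuityZ3.Theorems.Transplant.SkelFrmQuasiBParamsLF
import HarnessLib
import Summits.CriticalPhenomena.PercolationContinuityZ3.Theorems.Transplant.SkelFrmBChoiceRootClearRW
/-!
# GEN-Q PORT (WAVE-Q table v0.8 section 2, row G162, U-level L?; captain R-6/R-7 2026-08-27: carrier token swap `PlanarSkeletonFrmFrom ↦ PlanarSkeletonFrmQuasi`)
# of the tree module «Transplant/SkelFrmFromBChoiceRootClearRW» (sha256 bef6dbc4fd505874…) onto the quasi-step carrier `PlanarSkeletonFrmQuasi` (p507026): «SkelFrmQuasiBChoiceRootClearRW»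

ORIGINAL TITLE: N2 (frames-only node `SamePDropOfSkeletonFrm₁`, OPEN), (R) column SECOND axis — **THE SEED CLEARANCE `hclear₃` OF THE ROOT'S y′-CORRIDOR AT THE

builds on p205010 (kernel theorem, internal audit signed; external expert review pending) — nothing in this file uses p205010; NOTHING is claimed about any open node
((N3-b), the end state).  Lane `prim-bschramm`, seat `prim-hp-8` (gen 62; GEN-Q pen, family BChoiceRoot*/1Root*/BParamsKit·Bridge; tool = captain gen-1 g4's port_genq.py R-14 + p3-g30 T1/T2 + stmt-g33 --force-keep).  Helper file (`--supports stmt-CriticalPhenomena-4575 --as helper`).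
PORT RULES (U-wave r1–r4 re-used, GEN-Q hunk classes of p3-g29 #6136): declaration order, names and proof texts are those of «SkelFrmFromBChoiceRootClearRW», byte-identical except
(i) the carrier token `PlanarSkeletonFrmFrom ↦ PlanarSkeletonFrmQuasi` in binders, `namespace`/`end` lines and qualified names (module names `SkelFrmFrom… ↦ SkelFrmQuasi…`
in imports of already-ported rows); (ii) `Φ.step ↦ Φ.qstep` with the called Steps lemma replaced by its `…Q`/`_q` twin and the cost `Φ.M` threaded (none in this file unless
listed below); (iii) `Φ.cyl_connected ↦ Φ.cyl_reach` readers (none unless listed); (iv) graph-ball radii / window floors ×`Φ.M` (none unless listed).  HAND HUNK (L-KitS-1 / L-FLOORMAP-1 ⑧): the kit's R′ is read at the window cost of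
record — `KS0.R'0 κ Φ t p D mk ↦ KS0.R'0N κ Φ (KS.NQ Φ) t p D mk` (stmt-g33's G017 «SkelFrmQuasiBChoiceNums», hp-8's «SkelFrmQuasiBParamsKitSN»).  Carrier-free
residents stay imported/exported from the original «SkelFrmBChoiceRootClearRW» exactly as in the FrmFrom port.  Docstrings and citations are the original's.

-/

noncomputable section

open scoped Classical

namespace Summit.CriticalPhenomena.PercolationContinuityZ3.Theorems.Transplant

namespace PlanarSkeletonFrmQuasi

namespace NegB

open Literature.Probability.Percolation Literature.Probability.LatticeModels SimpleGraph
open SkelConc (Consts)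
open Skelφ (rootFrame shearUnit kgSL kgSLY kgΔY kgNY KGYRows kgFarY kgXY kgM₁Y kgM₂Y)
open Neg

namespace KS

section ClearRW

variable (κ : Consts) {V : Type} [DecidableEq V] [Countable V] {G : SimpleGraph V} [G.LocallyFinite] (Φ : PlanarSkeletonFrmQuasi G) (t : V) (p : unitInterval)
  (D : Skelφ.StepI.DataNS V) (mk g f qxY WxY : ℕ)

/-- **THE SKELETON'S `hclear₃` (square-avoidance form of the V twin) AT THE (R-46) VALUES, WIDE-WINDOW ROW `XY ≤ 100·sL`**, for any planar map `ψ`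
and origin `c₂ = t + (X2R, Y2R)`: every region `k` of the root's y′-corridor misses the seed square of half-side `Rs`. [this work] -/
theorem hclear₃_RW (κ : Consts) {V : Type} [DecidableEq V] [Countable V] {G : SimpleGraph V} [G.LocallyFinite] (Φ : PlanarSkeletonFrmQuasi G) (t : V) (p : unitInterval) (D : Skelφ.StepI.DataNS V) (mk : ℕ) (g : ℕ) (f : ℕ) (qxY : ℕ) (WxY : ℕ) (hN : EqNumL κ Φ t p D g f) (hg : gFloorKG κ Φ t p D mk ≤ g) (hg2 : 40 * Neg.K κ * KS0.R'0N κ Φ (KS.NQ Φ) t p D mk ≤ g)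
    (hgR : 60 * (KS.Rs t D mk + 1) ≤ g) (hWxY : KS.Rs t D mk + 34 * nL κ Φ t p D g f + 29 * KS0.R'0N κ Φ (KS.NQ Φ) t p D mk + 2 ≤ WxY)
    (hqx20 : (qxY : ℤ) ≤ 20 * (kgSL (nL κ Φ t p D g f) (ℓL κ Φ t p D g f) (hL κ Φ t p D g f))) (h0 : (kgFarY (nL κ Φ t p D g f) (ℓL κ Φ t p D g f) (hL κ Φ t p D g f) (vL κ Φ t p D g f) (kgR κ Φ t p D mk) 0 (kgqY κ Φ t p D g f qxY) (kgWY κ Φ t p D g f WxY) 0) ≤ (kgTgtY0 κ Φ t p D g f mk)) (hXY : (kgXY (nL κ Φ t p D g f) (ℓL κ Φ t p D g f) (hL κ Φ t p D g f) (vL κ Φ t p D g f) (kgR κ Φ t p D mk) 0 (kgqY κ Φ t p D g f qxY) (kgWY κ Φ t p D g f WxY) (kgNYv0 κ Φ t p D g f mk qxY WxY)) ≤ 100 * (kgSL (nL κ Φ t p D g f) (ℓL κ Φ t p D g f) (hL κ Φ t p D g f)))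
    {ψ : V → Site 2} {c₂ : V} (hX2 : ψ c₂ 0 - ψ t 0 = (((KS.X2R κ Φ t p D mk g f WxY) : ℕ) : ℤ)) (hY2 : ψ c₂ 1 - ψ t 1 = (KS.Y2R κ Φ t p D mk g f WxY)) :
    ∀ k ≤ (Skelφ.kgCorrSchedY (kgYRows0_of κ Φ t p D g f mk qxY (KS.WxYR κ Φ t p D mk g f WxY) hN hg).hn (kgYRows0_of κ Φ t p D g f mk qxY (KS.WxYR κ Φ t p D mk g f WxY) hN hg).hv (kgYRows0_of κ Φ t p D g f mk qxY (KS.WxYR κ Φ t p D mk g f WxY) hN hg).hlay ((kgYRows0_of κ Φ t p D g f mk qxY (KS.WxYR κ Φ t p D mk g f WxY) hN hg).kgYVals_ok₁ (kgNYv0 κ Φ t p D g f mk qxY WxY)) ((kgYRows0_of κ Φ t p D g f mk qxY (KS.WxYR κ Φ t p D mk g f WxY) hN hg).kgYVals_ok₂ (kgNYv0 κ Φ t p D g f mk qxY WxY)) ((kgYRows0_of κ Φ t p D g f mk qxY (KS.WxYR κ Φ t p D mk g f WxY) hN hg).kgYVals_split (kgNYv0 κ Φ t p D g f mk qxY WxY))).N,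 ∀ w : V, Skelφ.runX ψ c₂ (nL κ Φ t p D g f) (hL κ Φ t p D g f) 1 w ∈ (Skelφ.kgCorrSchedY (kgYRows0_of κ Φ t p D g f mk qxY (KS.WxYR κ Φ t p D mk g f WxY) hN hg).hn (kgYRows0_of κ Φ t p D g f mk qxY (KS.WxYR κ Φ t p D mk g f WxY) hN hg).hv (kgYRows0_of κ Φ t p D g f mk qxY (KS.WxYR κ Φ t p D mk g f WxY) hN hg).hlay ((kgYRows0_of κ Φ t p D g f mk qxY (KS.WxYR κ Φ t p D mk g f WxY) hN hg).kgYVals_ok₁ (kgNYv0 κ Φ t p D g f mk qxY WxY)) ((kgYRows0_of κ Φ t p D g f mk qxY (KS.WxYR κ Φ t p D mk g f WxY) hN hg).kgYVals_ok₂ (kgNYv0 κ Φ t p D g f mk qxY WxY)) ((kgYRows0_of κ Φ t p D g f mk qxY (KS.WxYR κ Φ t p D mk g f WxY) hN hg).kgYVals_split (kgNYv0 κ Φ t p D g f mk qxY WxY))).region k →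
      (((KS.Rs t D mk) : ℕ) : ℤ) < rootFrame ψ t 1 w 0 ∨ (((KS.Rs t D mk) : ℕ) : ℤ) < rootFrame ψ t 1 w 1 ∨
        rootFrame ψ t 1 w 0 < -(((KS.Rs t D mk) : ℕ) : ℤ) ∨ rootFrame ψ t 1 w 1 < -(((KS.Rs t D mk) : ℕ) : ℤ) := by
  have HC := (kgYRows0_of κ Φ t p D g f mk qxY WxY hN hg)
  have HR := (kgYRows0_of κ Φ t p D g f mk qxY (KS.WxYR κ Φ t p D mk g f WxY) hN hg)
  obtain ⟨hn1, -⟩ := one_le_of_eqNumL κ Φ t p D g f hN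
  obtain ⟨r2lo, -, -⟩ := rows_c₂_zero κ Φ t p D mk g f WxY hN
  have hXYn : (hL κ Φ t p D g f) * (((KS.X2R κ Φ t p D mk g f WxY) : ℕ) : ℤ) ≤ (nL κ Φ t p D g f : ℤ) * (KS.Y2R κ Φ t p D mk g f WxY) := by linarith
  have hxrow := hxrow_R κ Φ t p D mk g f WxY hN hWxY
  have hfloor := runFloorY_R κ Φ t p D mk g f qxY WxY hN hg h0
  have hpitch := pitchY_ge κ Φ t p D g f hN
  -- floors
  obtain ⟨hKR, hKs, h958, hR1, hK, -⟩ := valsQ_floor κ Φ t p D g f mk hN hg hg2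
  have hsL := ML_sub_one_le_kgSL κ Φ t p D g f hN
  have hgML : g ≤ ML κ Φ t p D g := (ML_le_ML κ Φ t p D g).2
  have hRs : 60 * ((((KS.Rs t D mk) : ℕ) : ℤ) + 1) ≤ (kgSL (nL κ Φ t p D g f) (ℓL κ Φ t p D g f) (hL κ Φ t p D g f)) + 1 := by
    have : ((60 * (KS.Rs t D mk + 1) : ℕ) : ℤ) ≤ ((ML κ Φ t p D g : ℕ) : ℤ) := by exact_mod_cast hgR.trans hgML
    push_cast at this; linarith
  have hR0 : (0 : ℤ) ≤ (((kgR κ Φ t p D mk) : ℕ) : ℤ) := by positivity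
  have eR : (kgR κ Φ t p D mk) = (KS0.R'0N κ Φ (KS.NQ Φ) t p D mk) := rfl
  have h1600 : 1600 * (((kgR κ Φ t p D mk) : ℕ) : ℤ) ≤ (kgSL (nL κ Φ t p D g f) (ℓL κ Φ t p D g f) (hL κ Φ t p D g f)) + 1 := by rw [eR]; nlinarith
  have hU : 0 < shearUnit (nL κ Φ t p D g f) (hL κ Φ t p D g f) := by unfold Skelφ.shearUnit; omega
  have hP : ((((nL κ Φ t p D g f) * (ℓL κ Φ t p D g f) / shearUnit (nL κ Φ t p D g f) (hL κ Φ t p D g f) : ℕ)) : ℤ) ≤ (kgSLY (nL κ Φ t p D g f) (ℓL κ Φ t p D g f) (hL κ Φ t p D g f)) + 1 := Skelφ.natDiv_le_kgSLY hn1 (ℓL κ Φ t p D g f) (hL κ Φ t p D g f)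
  have eσ' : (kgSLY (nL κ Φ t p D g f) (ℓL κ Φ t p D g f) (hL κ Φ t p D g f)) = (kgSL (nL κ Φ t p D g f) (ℓL κ Φ t p D g f) (hL κ Φ t p D g f)) := rfl
  rw [eσ'] at hP
  have hL3 := Skelφ.natDiv_three_le ((nL κ Φ t p D g f) * (ℓL κ Φ t p D g f)) (shearUnit (nL κ Φ t p D g f) (hL κ Φ t p D g f)) hU
  have hL6 : (((3 * ((nL κ Φ t p D g f) * (ℓL κ Φ t p D g f)) / shearUnit (nL κ Φ t p D g f) (hL κ Φ t p D g f) + 1 : ℕ)) : ℤ) ≤ 3 * (kgSL (nL κ Φ t p D g f) (ℓL κ Φ t p D g f) (hL κ Φ t p D g f)) + 6 := by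
    have : ((3 * ((nL κ Φ t p D g f) * (ℓL κ Φ t p D g f)) / shearUnit (nL κ Φ t p D g f) (hL κ Φ t p D g f) : ℕ) : ℤ) ≤ 3 * ((((nL κ Φ t p D g f) * (ℓL κ Φ t p D g f) / shearUnit (nL κ Φ t p D g f) (hL κ Φ t p D g f) : ℕ)) : ℤ) + 2 := by exact_mod_cast hL3
    push_cast at this hP ⊢; linarith
  have hPe : ((((nL κ Φ t p D g f) * (ℓL κ Φ t p D g f) / shearUnit (nL κ Φ t p D g f) (hL κ Φ t p D g f) + 1 : ℕ)) : ℤ) ≤ (kgSL (nL κ Φ t p D g f) (ℓL κ Φ t p D g f) (hL κ Φ t p D g f)) + 2 := by push_cast at hP ⊢; linarith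
  have hq : (((kgqY κ Φ t p D g f qxY) : ℕ) : ℤ) = ((((nL κ Φ t p D g f) * (ℓL κ Φ t p D g f) / shearUnit (nL κ Φ t p D g f) (hL κ Φ t p D g f) + 1 : ℕ)) : ℤ) + qxY := by unfold kgqY; push_cast; ring
  have hPe' : ((nL κ Φ t p D g f : ℤ)) * ((((ℓL κ Φ t p D g f)) : ℕ) : ℤ) / ((shearUnit (nL κ Φ t p D g f) (hL κ Φ t p D g f) : ℕ) : ℤ) + 1 ≤ (kgSL (nL κ Φ t p D g f) (ℓL κ Φ t p D g f) (hL κ Φ t p D g f)) + 2 := by push_cast at hP ⊢; linarith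
  have eσ : ((((nL κ Φ t p D g f) : ℤ) * (ℓL κ Φ t p D g f) - (shearUnit (nL κ Φ t p D g f) (hL κ Φ t p D g f) : ℕ) + 1) / (shearUnit (nL κ Φ t p D g f) (hL κ Φ t p D g f) : ℕ)) = (kgSL (nL κ Φ t p D g f) (ℓL κ Φ t p D g f) (hL κ Φ t p D g f)) := rfl
  have hΔ : kgΔY (kgR κ Φ t p D mk) 0 = 3 * (((kgR κ Φ t p D mk) : ℕ) : ℤ) + 2 * ((0 : ℕ) : ℤ) + 2 := rfl
  have htgt : pitchY κ Φ t p D g f ≤ (kgTgtY0 κ Φ t p D g f mk) := by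
    have hPn : (0 : ℤ) ≤ ((((nL κ Φ t p D g f) * (ℓL κ Φ t p D g f) / shearUnit (nL κ Φ t p D g f) (hL κ Φ t p D g f) : ℕ)) : ℤ) := by positivity
    have a1 : (0 : ℤ) ≤ (((((nL κ Φ t p D g f) * (ℓL κ Φ t p D g f) / shearUnit (nL κ Φ t p D g f) (hL κ Φ t p D g f) + 1 : ℕ)) : ℤ) - 1) / 2 := Int.ediv_nonneg (by push_cast at hPn ⊢; linarith) (by norm_num)
    have hΔ0 : (0 : ℤ) ≤ kgΔY (kgR κ Φ t p D mk) 0 := by unfold kgΔY; positivity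
    have hsY0 : (0 : ℤ) ≤ (kgSLY (nL κ Φ t p D g f) (ℓL κ Φ t p D g f) (hL κ Φ t p D g f)) := by rw [eσ']; linarith
    have a2 : (0 : ℤ) ≤ ((kgSLY (nL κ Φ t p D g f) (ℓL κ Φ t p D g f) (hL κ Φ t p D g f)) + kgΔY (kgR κ Φ t p D mk) 0) / 2 := Int.ediv_nonneg (by linarith) (by norm_num)
    unfold kgTgtY0
    linarith
  have hm₁0 : (0 : ℤ) ≤ ((((kgM₁Y (nL κ Φ t p D g f) (vL κ Φ t p D g f) (kgR κ Φ t p D mk) 0 (kgWY κ Φ t p D g f (KS.WxYR κ Φ t p D mk g f WxY)) (kgNYv0 κ Φ t p D g f mk qxY WxY))) : ℕ) : ℤ) := by positivity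
  have hN0 : (0 : ℤ) ≤ (((kgNYv0 κ Φ t p D g f mk qxY WxY) : ℕ) : ℤ) := by positivity
  have hs0 : (0 : ℤ) ≤ (kgSL (nL κ Φ t p D g f) (ℓL κ Φ t p D g f) (hL κ Φ t p D g f)) := by linarith
  have h800 : 800 * (kgSL (nL κ Φ t p D g f) (ℓL κ Φ t p D g f) (hL κ Φ t p D g f)) ≤ 20 * (Neg.K κ : ℤ) * (kgSL (nL κ Φ t p D g f) (ℓL κ Φ t p D g f) (hL κ Φ t p D g f)) := mul_le_mul_of_nonneg_right (by linarith) hs0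
  rw [hΔ, eσ'] at hfloor
  simp only [Nat.cast_zero, mul_zero, add_zero] at hfloor
  refine Skelφ.clear_of_kgCorrSchedY_rows4 HR.hn HR.hv HR.hlay (HR.kgYVals_ok₁ (kgNYv0 κ Φ t p D g f mk qxY WxY)) (HR.kgYVals_ok₂ (kgNYv0 κ Φ t p D g f mk qxY WxY)) (HR.kgYVals_split (kgNYv0 κ Φ t p D g f mk qxY WxY))
    t c₂ hX2 hY2 hXYn 28 ?_ ?_ ?_ ?_
  · intro k hk
    exact hxrow k hk
  · intro k hk1 _hk2
    rw [eσ, hq]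
    have hk29 : (29 : ℤ) ≤ k := by exact_mod_cast hk1
    have hsR : (0 : ℤ) ≤ (kgSL (nL κ Φ t p D g f) (ℓL κ Φ t p D g f) (hL κ Φ t p D g f)) - (((kgR κ Φ t p D mk) : ℕ) : ℤ) := by linarith
    have hprod : 29 * ((kgSL (nL κ Φ t p D g f) (ℓL κ Φ t p D g f) (hL κ Φ t p D g f)) - (((kgR κ Φ t p D mk) : ℕ) : ℤ)) ≤ (k : ℤ) * ((kgSL (nL κ Φ t p D g f) (ℓL κ Φ t p D g f) (hL κ Φ t p D g f)) - (((kgR κ Φ t p D mk) : ℕ) : ℤ)) := mul_le_mul_of_nonneg_right hk29 hsR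
    linarith only [hprod, hPe, hqx20, hL6, hRs, h1600, h958, hR0]
  · intro j hj
    rw [eσ]
    simp only [Nat.cast_zero, add_zero]
    have hj' : (j : ℤ) ≤ ((((kgM₁Y (nL κ Φ t p D g f) (vL κ Φ t p D g f) (kgR κ Φ t p D mk) 0 (kgWY κ Φ t p D g f (KS.WxYR κ Φ t p D mk g f WxY)) (kgNYv0 κ Φ t p D g f mk qxY WxY))) : ℕ) : ℤ) + 1 := by
      have : (j : ℤ) ≤ ((((kgM₁Y (nL κ Φ t p D g f) (vL κ Φ t p D g f) (kgR κ Φ t p D mk) 0 (kgWY κ Φ t p D g f (KS.WxYR κ Φ t p D mk g f WxY)) (kgNYv0 κ Φ t p D g f mk qxY WxY))) : ℕ) : ℤ) := by exact_mod_cast hj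
      linarith
    have hjR : (j : ℤ) * (((kgR κ Φ t p D mk) : ℕ) : ℤ) ≤ (((((kgM₁Y (nL κ Φ t p D g f) (vL κ Φ t p D g f) (kgR κ Φ t p D mk) 0 (kgWY κ Φ t p D g f (KS.WxYR κ Φ t p D mk g f WxY)) (kgNYv0 κ Φ t p D g f mk qxY WxY))) : ℕ) : ℤ) + 1) * (((kgR κ Φ t p D mk) : ℕ) : ℤ) := mul_le_mul_of_nonneg_right hj' hR0
    linarith only [hfloor, hjR, htgt, hpitch, h800, hXY, hL6, hRs, h1600, h958, hR0]
  · rw [eσ]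
    simp only [Nat.cast_zero, add_zero]
    linarith only [hfloor, htgt, hpitch, h800, hXY, hL6, hPe', hRs, h1600, h958, hR0, hm₁0]

end ClearRW

end KS

end NegB

end PlanarSkeletonFrmQuasi

end Summit.CriticalPhenomena.PercolationContinuityZ3.Theorems.Transplant

end
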